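import Mathlib
import Summits.ValiantsHypothesis.ValiantsHypothesis.Theorems.KPlusLogSqLawWeakLiftingTowerGraftSkewBlockIdentityGraftSharpTower
import Summits.ValiantsHypothesis.ValiantsHypothesis.Theorems.KPlusLogSqLawWeakLiftingTowerGraftSkewBlockAxisPairCrossings
import Summits.ValiantsHypothesis.ValiantsHypothesis.Theorems.KPlusLogSqLawWeakLiftingTowerGraftSkewBlockAxisPairMixing

/-!
# Tower graft line — Θ(m²) PHANTOMS OF THE INDEFINITE AXIS-PAIR GRAFT WITH ALL EVENTS EMPTY, every even size, every exponent, also on genuine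
# towers («phantoms are not a fold phenomenon»)

Calibration file for the line `Cruxes/WeakLifting/Lines/tower_graft.lean` (crux `WeakLifting` = stmt-ValiantsHypothesis-19561), memo §18; the
NO-GO companion of the fold law p709692 (rank-two indefinite far letters: events (E0) (Er) (Ed) class-paid).  NO stub is claimed.

* ★ `skewBlock_axisPair_of_sharp` — ROOT COUNTING SUFFICES: a Descartes-sharp square block pencil `B` of size `q+2` and `i ≠ 0` admit ONE real
  mixing `P` (`det P ≠ 0`; `…AxisPairMixing`) such that for EVERY exponent `D` some `η > 0` gives, for the skew-block pencil `G_η` (size `2(q+2)`)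
  and the far letter `S = E_{inr 0} − E_{inr i}`: ALL FOUR event polynomials of `…FoldLawAxisPair` ROOTLESS on `(0,∞)` — (E0) `det G_η` (p688917),
  (Er) the pair minor, (Ed) both fold factors (`…AxisPairEvents`) — and `Z₊(det(G_η + X^D·S)) ≥ 2·Z₊(det B)` (`…AxisPairCrossings`).
* ★★ `skewBlock_axisPair_quadratic (q)` — fed with the tree's Descartes-sharp symmetric `(q+2, 3)` family (`not_posRootLawAt_three`):
  `(q+2)(q+5) = m²/4 + 3m/2` phantoms (`m = 2(q+2)`) with (E0), (Er), both (Ed) EMPTY, every exponent;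
  `skewBlock_axisPair_quadratic_tower (q)` — the same on the genuine `m`-tower `(0, 1, D)` (`witnessLetters (q+2) D`, p706847), tower
  inequalities as conjuncts, every corner exponent `D'`.

READING (memo §18 / NO-GO ledger): for the first INDEFINITE rung the picture is two-sided in the kernel — folds ARE class events (p709692,
positive), and a family with NO event of any of the three kinds still carries `m²/4 + 3m/2` phantoms (negative): no instance-level law
`Z₊(graft) ≤ c·(#E0 + #Er + #Ed) + o(m²)` exists for S5's object at rank two either; only the class budget pays (inside which every count
here sits: `B ≥ ζ₊ ≥ C(m+2,2) − 1` — ZERO crux credit).  HONEST FRAMING: nothing on S4/S4b/S5/S5ᴸ, TowerB, `WeakLifting`, Conjecture B,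
`MatrixDescartes` (18050) or `VP ≠ VNP`.  Def-free.  Seat: prover val-sym-lift-p2 g21, `--supports stmt-ValiantsHypothesis-19561`.
-/

-- `Summit.ValiantsHypothesis.ValiantsHypothesis.…` repeats a component by the D-0017 layout
-- (single-conjunct summit), which the `dupNamespace` linter flags; the name is mandated.
set_option linter.dupNamespace false

namespace Summit.ValiantsHypothesis.ValiantsHypothesis.Theorems.KPlusLogSqLaw.TowerGraft

open Polynomial Matrix
open scoped BigOperators Polynomial
open Summit.ValiantsHypothesis.ValiantsHypothesis.Theorems.LacunarySymmetroidMatrixDescartes.Census.LagrangeTower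

section AxisPairSharp

/-- **THE NO-GO FAMILY FOR THE INDEFINITE AXIS PAIR, FROM ROOT COUNTING ALONE.**  A Descartes-sharp square block pencil `B` of size `q+2`
(`det B ≠ 0`, `#supp(det B) ≤ Z₊(det B) + 1`) and an index `i ≠ 0` admit ONE real mixing `P` (`det P ≠ 0`; blocks `Bₗ·P`: same support, same
root set) such that for EVERY exponent `D` some `η > 0` gives, for the symmetric skew-block pencil `G_η` of size `2(q+2)` and the far letter
`S = E_{inr 0} − E_{inr i}` (rank two, signature `(1,1)`): ALL FOUR EVENT POLYNOMIALS of `…FoldLawAxisPair` are ROOTLESS on `(0,∞)` — `det G_η` (E0),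
the pair minor `ε` (Er), and both fold factors (Ed) — while `Z₊(det(G_η + X^D·S)) ≥ 2·Z₊(det B)`. [this work] -/
theorem skewBlock_axisPair_of_sharp {q K : ℕ} (d : Fin K → ℕ) (l₀ : Fin K) (B : Fin K → Matrix (Fin (q + 2)) (Fin (q + 2)) ℝ)
    (hdet : (∑ l, (X : ℝ[X]) ^ d l • (B l).map C).det ≠ 0)
    (hsharp : (∑ l, (X : ℝ[X]) ^ d l • (B l).map C).det.support.card ≤
      ((∑ l, (X : ℝ[X]) ^ d l • (B l).map C).det.roots.toFinset.filter (fun t => 0 < t)).card + 1)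
    (i : Fin (q + 2)) (hi : i ≠ 0) :
    ∃ P : Matrix (Fin (q + 2)) (Fin (q + 2)) ℝ, P.det ≠ 0 ∧ ∀ D : ℕ, ∃ η : ℝ, 0 < η ∧
      ((∑ l, (X : ℝ[X]) ^ d l • (Matrix.fromBlocks (if l = l₀ then η • (1 : Matrix (Fin (q + 2)) (Fin (q + 2)) ℝ) else 0)
        (B l * P) (B l * P)ᵀ (if l = l₀ then -(η • (1 : Matrix (Fin (q + 2)) (Fin (q + 2)) ℝ)) else 0)).map C).det.roots.toFinset.filter
        (fun t => 0 < t)).card = 0 ∧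
      ((((∑ l, (X : ℝ[X]) ^ d l • (Matrix.fromBlocks (if l = l₀ then η • (1 : Matrix (Fin (q + 2)) (Fin (q + 2)) ℝ) else 0)
        (B l * P) (B l * P)ᵀ (if l = l₀ then -(η • (1 : Matrix (Fin (q + 2)) (Fin (q + 2)) ℝ)) else 0)).map C).updateRow (Sum.inr 0)
        (Pi.single (Sum.inr 0) 1)).updateRow (Sum.inr i) (Pi.single (Sum.inr i) 1)).det.roots.toFinset.filter (fun t => 0 < t)).card = 0 ∧
      ((((Matrix.transvection (Sum.inr i : Fin (q + 2) ⊕ Fin (q + 2)) (Sum.inr 0) (1 : ℝ[X]))ᵀ *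
        (∑ l, (X : ℝ[X]) ^ d l • (Matrix.fromBlocks (if l = l₀ then η • (1 : Matrix (Fin (q + 2)) (Fin (q + 2)) ℝ) else 0)
          (B l * P) (B l * P)ᵀ (if l = l₀ then -(η • (1 : Matrix (Fin (q + 2)) (Fin (q + 2)) ℝ)) else 0)).map C) *
        Matrix.transvection (Sum.inr i : Fin (q + 2) ⊕ Fin (q + 2)) (Sum.inr 0) (1 : ℝ[X])).adjugate (Sum.inr i) (Sum.inr i)).roots.toFinset.filter
        (fun t => 0 < t)).card = 0 ∧
      ((((Matrix.transvection (Sum.inr i : Fin (q + 2) ⊕ Fin (q + 2)) (Sum.inr 0) (-1 : ℝ[X]))ᵀ *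
        (∑ l, (X : ℝ[X]) ^ d l • (Matrix.fromBlocks (if l = l₀ then η • (1 : Matrix (Fin (q + 2)) (Fin (q + 2)) ℝ) else 0)
          (B l * P) (B l * P)ᵀ (if l = l₀ then -(η • (1 : Matrix (Fin (q + 2)) (Fin (q + 2)) ℝ)) else 0)).map C) *
        Matrix.transvection (Sum.inr i : Fin (q + 2) ⊕ Fin (q + 2)) (Sum.inr 0) (-1 : ℝ[X])).adjugate (Sum.inr i) (Sum.inr i)).roots.toFinset.filter
        (fun t => 0 < t)).card = 0 ∧
      2 * ((∑ l, (X : ℝ[X]) ^ d l • (B l).map C).det.roots.toFinset.filter (fun t => 0 < t)).card ≤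
        ((((∑ l, (X : ℝ[X]) ^ d l • (Matrix.fromBlocks (if l = l₀ then η • (1 : Matrix (Fin (q + 2)) (Fin (q + 2)) ℝ) else 0)
          (B l * P) (B l * P)ᵀ (if l = l₀ then -(η • (1 : Matrix (Fin (q + 2)) (Fin (q + 2)) ℝ)) else 0)).map C) +
        (X : ℝ[X]) ^ D • (Matrix.single (Sum.inr 0 : Fin (q + 2) ⊕ Fin (q + 2)) (Sum.inr 0) (1 : ℝ[X]) -
          Matrix.single (Sum.inr i : Fin (q + 2) ⊕ Fin (q + 2)) (Sum.inr i) (1 : ℝ[X]))).det).roots.toFinset.filter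
        (fun t => 0 < t)).card := by
  classical
  obtain ⟨P, τ, ρ, hP, hτρ, hρτ, hτpos, hτB, hρB, hρB''⟩ := exists_sharp_mixing_certificate d B hdet hsharp
  obtain ⟨P', hP'det, hτB', hρB', hdom⟩ := exists_dominant_mixing d B _ P τ ρ hP hτB hρB hρB'' i hi
  refine ⟨P', hP'det, fun D => ?_⟩
  have hi0 : i ≠ (0 : Fin (q + 2)) := hi
  obtain ⟨η, hη, hN⟩ := skewBlock_axisPair_crossings d l₀ D (fun l => B l * P') hi0 _ τ ρ hτρ hρτ hτpos hτB' hρB' hdom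
  have h0i : (0 : Fin (q + 2)) ≠ i := fun h => hi h.symm
  refine ⟨η, hη, card_posRoots_det_skewBlock_pencil_eq_zero d l₀ hη.ne' _,
    card_posRoots_pairMinor_skewBlock_eq_zero d l₀ hη.ne' _ h0i, ?_, ?_, hN⟩
  · have h := card_posRoots_foldFactor_skewBlock_eq_zero d l₀ hη.ne' (fun l => B l * P') h0i 1
    rwa [map_one] at h
  · have h := card_posRoots_foldFactor_skewBlock_eq_zero d l₀ hη.ne' (fun l => B l * P') h0i (-1)
    rwa [map_neg, map_one] at h

open Summit.ValiantsHypothesis.ValiantsHypothesis.Theorems.MatrixDescartes.Negative (PosRootLawAt) in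
/-- **Θ(m²) PHANTOMS OF THE INDEFINITE AXIS-PAIR GRAFT WITH ALL EVENTS EMPTY — every even size `m = 2(q+2)`, every exponent** (calibration; the
NO-GO companion of the fold law).  Data: the tree's Descartes-sharp symmetric `(q+2, 3)` family (`not_posRootLawAt_three`), mixed; count
`2·(C(q+4,2) − 1) = (q+2)(q+5) = m²/4 + 3m/2`.  «Phantoms are not a fold phenomenon.» [this work] -/
theorem skewBlock_axisPair_quadratic (q : ℕ) :
    ∃ (d : Fin 3 → ℕ) (B : Fin 3 → Matrix (Fin (q + 2)) (Fin (q + 2)) ℝ), ∀ D : ℕ, ∃ η : ℝ, 0 < η ∧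
      ((∑ l, (X : ℝ[X]) ^ d l • (Matrix.fromBlocks (if l = 0 then η • (1 : Matrix (Fin (q + 2)) (Fin (q + 2)) ℝ) else 0)
        (B l) (B l)ᵀ (if l = 0 then -(η • (1 : Matrix (Fin (q + 2)) (Fin (q + 2)) ℝ)) else 0)).map C).det.roots.toFinset.filter
        (fun t => 0 < t)).card = 0 ∧
      ((((∑ l, (X : ℝ[X]) ^ d l • (Matrix.fromBlocks (if l = 0 then η • (1 : Matrix (Fin (q + 2)) (Fin (q + 2)) ℝ) else 0)
        (B l) (B l)ᵀ (if l = 0 then -(η • (1 : Matrix (Fin (q + 2)) (Fin (q + 2)) ℝ)) else 0)).map C).updateRow (Sum.inr 0)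
        (Pi.single (Sum.inr 0) 1)).updateRow (Sum.inr 1) (Pi.single (Sum.inr 1) 1)).det.roots.toFinset.filter (fun t => 0 < t)).card = 0 ∧
      ((((Matrix.transvection (Sum.inr 1 : Fin (q + 2) ⊕ Fin (q + 2)) (Sum.inr 0) (1 : ℝ[X]))ᵀ *
        (∑ l, (X : ℝ[X]) ^ d l • (Matrix.fromBlocks (if l = 0 then η • (1 : Matrix (Fin (q + 2)) (Fin (q + 2)) ℝ) else 0)
          (B l) (B l)ᵀ (if l = 0 then -(η • (1 : Matrix (Fin (q + 2)) (Fin (q + 2)) ℝ)) else 0)).map C) *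
        Matrix.transvection (Sum.inr 1 : Fin (q + 2) ⊕ Fin (q + 2)) (Sum.inr 0) (1 : ℝ[X])).adjugate (Sum.inr 1) (Sum.inr 1)).roots.toFinset.filter
        (fun t => 0 < t)).card = 0 ∧
      ((((Matrix.transvection (Sum.inr 1 : Fin (q + 2) ⊕ Fin (q + 2)) (Sum.inr 0) (-1 : ℝ[X]))ᵀ *
        (∑ l, (X : ℝ[X]) ^ d l • (Matrix.fromBlocks (if l = 0 then η • (1 : Matrix (Fin (q + 2)) (Fin (q + 2)) ℝ) else 0)
          (B l) (B l)ᵀ (if l = 0 then -(η • (1 : Matrix (Fin (q + 2)) (Fin (q + 2)) ℝ)) else 0)).map C) *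
        Matrix.transvection (Sum.inr 1 : Fin (q + 2) ⊕ Fin (q + 2)) (Sum.inr 0) (-1 : ℝ[X])).adjugate (Sum.inr 1) (Sum.inr 1)).roots.toFinset.filter
        (fun t => 0 < t)).card = 0 ∧
      (q + 2) * (q + 5) ≤ ((((∑ l, (X : ℝ[X]) ^ d l • (Matrix.fromBlocks (if l = 0 then η • (1 : Matrix (Fin (q + 2)) (Fin (q + 2)) ℝ) else 0)
          (B l) (B l)ᵀ (if l = 0 then -(η • (1 : Matrix (Fin (q + 2)) (Fin (q + 2)) ℝ)) else 0)).map C) +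
        (X : ℝ[X]) ^ D • (Matrix.single (Sum.inr 0 : Fin (q + 2) ⊕ Fin (q + 2)) (Sum.inr 0) (1 : ℝ[X]) -
          Matrix.single (Sum.inr 1 : Fin (q + 2) ⊕ Fin (q + 2)) (Sum.inr 1) (1 : ℝ[X]))).det).roots.toFinset.filter
        (fun t => 0 < t)).card := by
  classical
  have hsharpFam := LacunarySymmetroidMatrixDescartes.Census.LagrangeTower.not_posRootLawAt_three (q + 2) (by omega)
  simp only [PosRootLawAt, not_forall, not_le, exists_prop] at hsharpFam
  obtain ⟨d, S, -, hcard⟩ := hsharpFam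
  have hch : Nat.choose (q + 2 + 2) 2 = Nat.choose (q + 4) 2 := by rw [show q + 2 + 2 = q + 4 by ring]
  rw [hch] at hcard
  have hdet : (∑ l, (X : ℝ[X]) ^ d l • (S l).map C).det ≠ 0 := by
    intro h0
    rw [h0, Polynomial.roots_zero, Multiset.toFinset_zero, Finset.filter_empty, Finset.card_empty] at hcard
    have h2 : Nat.choose (0 + 4) 2 ≤ Nat.choose (q + 4) 2 := Nat.choose_le_choose 2 (by omega)
    have h3 : Nat.choose (0 + 4) 2 = 6 := by decide
    omega
  have hsupp := LacunarySymmetroidMatrixDescartes.StubDescartesCeiling.card_support_det_pencil_le d S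
  have hch2 : Nat.choose (q + 2 + 3 - 1) (q + 2) = Nat.choose (q + 4) 2 := by
    rw [show q + 2 + 3 - 1 = q + 4 by omega, show q + 4 = (q + 2) + 2 by ring, Nat.choose_symm_add]
  rw [hch2] at hsupp
  have hsharp : (∑ l, (X : ℝ[X]) ^ d l • (S l).map C).det.support.card ≤
      ((∑ l, (X : ℝ[X]) ^ d l • (S l).map C).det.roots.toFinset.filter (fun t => 0 < t)).card + 1 := by omega
  have h10 : (1 : Fin (q + 2)) ≠ 0 := by simp
  obtain ⟨P, -, hP⟩ := skewBlock_axisPair_of_sharp d 0 S hdet hsharp 1 h10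
  refine ⟨d, fun l => S l * P, fun D => ?_⟩
  obtain ⟨η, hη, h1, h2, h3, h4, h5⟩ := hP D
  refine ⟨η, hη, h1, h2, h3, h4, le_trans ?_ h5⟩
  have := two_mul_choose_sub_one (q + 1)
  rw [show q + 1 + 3 = q + 4 by ring, show q + 1 + 1 = q + 2 by ring, show q + 1 + 4 = q + 5 by ring] at this
  omega

/-- **THE SAME ON A GENUINE TOWER** (S5's hypotheses `IsTower`, corner exponent above the tower, met): support `(0, 1, D)` with
`2(q+2)·1 < D` (the arrowhead Lagrange tower blocks `witnessLetters (q+2) D`, mixed), tower inequalities as conjuncts, and for EVERY exponent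
`D'` an `η > 0` with all four event polynomials rootless and `(q+2)(q+5)` phantoms. [this work] -/
theorem skewBlock_axisPair_quadratic_tower (q : ℕ) :
    ∃ (D : ℕ) (B : Fin 3 → Matrix (Fin (q + 2)) (Fin (q + 2)) ℝ),
      (∀ l l' : Fin 3, l < l' → 2 * (q + 2) * (![0, 1, D] : Fin 3 → ℕ) l < (![0, 1, D] : Fin 3 → ℕ) l') ∧
      (∀ l : Fin 3, 2 * (q + 2) * (![0, 1, D] : Fin 3 → ℕ) l < 2 * (q + 2) * D + 1) ∧
      ∀ D' : ℕ, ∃ η : ℝ, 0 < η ∧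
      ((∑ l, (X : ℝ[X]) ^ (![0, 1, D] : Fin 3 → ℕ) l •
        (Matrix.fromBlocks (if l = 0 then η • (1 : Matrix (Fin (q + 2)) (Fin (q + 2)) ℝ) else 0)
        (B l) (B l)ᵀ (if l = 0 then -(η • (1 : Matrix (Fin (q + 2)) (Fin (q + 2)) ℝ)) else 0)).map C).det.roots.toFinset.filter
        (fun t => 0 < t)).card = 0 ∧
      ((((∑ l, (X : ℝ[X]) ^ (![0, 1, D] : Fin 3 → ℕ) l •
        (Matrix.fromBlocks (if l = 0 then η • (1 : Matrix (Fin (q + 2)) (Fin (q + 2)) ℝ) else 0)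
        (B l) (B l)ᵀ (if l = 0 then -(η • (1 : Matrix (Fin (q + 2)) (Fin (q + 2)) ℝ)) else 0)).map C).updateRow (Sum.inr 0)
        (Pi.single (Sum.inr 0) 1)).updateRow (Sum.inr 1) (Pi.single (Sum.inr 1) 1)).det.roots.toFinset.filter (fun t => 0 < t)).card = 0 ∧
      ((((Matrix.transvection (Sum.inr 1 : Fin (q + 2) ⊕ Fin (q + 2)) (Sum.inr 0) (1 : ℝ[X]))ᵀ *
        (∑ l, (X : ℝ[X]) ^ (![0, 1, D] : Fin 3 → ℕ) l •
          (Matrix.fromBlocks (if l = 0 then η • (1 : Matrix (Fin (q + 2)) (Fin (q + 2)) ℝ) else 0)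
          (B l) (B l)ᵀ (if l = 0 then -(η • (1 : Matrix (Fin (q + 2)) (Fin (q + 2)) ℝ)) else 0)).map C) *
        Matrix.transvection (Sum.inr 1 : Fin (q + 2) ⊕ Fin (q + 2)) (Sum.inr 0) (1 : ℝ[X])).adjugate (Sum.inr 1) (Sum.inr 1)).roots.toFinset.filter
        (fun t => 0 < t)).card = 0 ∧
      ((((Matrix.transvection (Sum.inr 1 : Fin (q + 2) ⊕ Fin (q + 2)) (Sum.inr 0) (-1 : ℝ[X]))ᵀ *
        (∑ l, (X : ℝ[X]) ^ (![0, 1, D] : Fin 3 → ℕ) l •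
          (Matrix.fromBlocks (if l = 0 then η • (1 : Matrix (Fin (q + 2)) (Fin (q + 2)) ℝ) else 0)
          (B l) (B l)ᵀ (if l = 0 then -(η • (1 : Matrix (Fin (q + 2)) (Fin (q + 2)) ℝ)) else 0)).map C) *
        Matrix.transvection (Sum.inr 1 : Fin (q + 2) ⊕ Fin (q + 2)) (Sum.inr 0) (-1 : ℝ[X])).adjugate (Sum.inr 1) (Sum.inr 1)).roots.toFinset.filter
        (fun t => 0 < t)).card = 0 ∧
      (q + 2) * (q + 5) ≤ ((((∑ l, (X : ℝ[X]) ^ (![0, 1, D] : Fin 3 → ℕ) l •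
          (Matrix.fromBlocks (if l = 0 then η • (1 : Matrix (Fin (q + 2)) (Fin (q + 2)) ℝ) else 0) (B l) (B l)ᵀ
          (if l = 0 then -(η • (1 : Matrix (Fin (q + 2)) (Fin (q + 2)) ℝ)) else 0)).map C) +
        (X : ℝ[X]) ^ D' • (Matrix.single (Sum.inr 0 : Fin (q + 2) ⊕ Fin (q + 2)) (Sum.inr 0) (1 : ℝ[X]) -
          Matrix.single (Sum.inr 1 : Fin (q + 2) ⊕ Fin (q + 2)) (Sum.inr 1) (1 : ℝ[X]))).det).roots.toFinset.filter
        (fun t => 0 < t)).card := by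
  classical
  obtain ⟨D, hDb, hcard⟩ := le_card_posRoots_witness (q + 2) (by omega) (2 * (q + 2) + 1)
  have hexps : witnessExps D = (![0, 1, D] : Fin 3 → ℕ) := rfl
  rw [hexps] at hcard
  have hch : Nat.choose (q + 2 + 2) 2 = Nat.choose (q + 4) 2 := by rw [show q + 2 + 2 = q + 4 by ring]
  rw [hch] at hcard
  set S := witnessLetters (q + 2) D with hS
  have hcard' : Nat.choose (q + 4) 2 - 1 ≤
      ((∑ l, (X : ℝ[X]) ^ (![0, 1, D] : Fin 3 → ℕ) l • (S l).map C).det.roots.toFinset.filter (fun t => 0 < t)).card := hcard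
  clear hcard
  have hdet : (∑ l, (X : ℝ[X]) ^ (![0, 1, D] : Fin 3 → ℕ) l • (S l).map C).det ≠ 0 := by
    intro h0
    rw [h0, Polynomial.roots_zero, Multiset.toFinset_zero, Finset.filter_empty, Finset.card_empty] at hcard'
    have h2 : Nat.choose (0 + 4) 2 ≤ Nat.choose (q + 4) 2 := Nat.choose_le_choose 2 (by omega)
    have h3 : Nat.choose (0 + 4) 2 = 6 := by decide
    omega
  have hsupp := LacunarySymmetroidMatrixDescartes.StubDescartesCeiling.card_support_det_pencil_le (![0, 1, D] : Fin 3 → ℕ) S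
  have hch2 : Nat.choose (q + 2 + 3 - 1) (q + 2) = Nat.choose (q + 4) 2 := by
    rw [show q + 2 + 3 - 1 = q + 4 by omega, show q + 4 = (q + 2) + 2 by ring, Nat.choose_symm_add]
  rw [hch2] at hsupp
  have hsharp : (∑ l, (X : ℝ[X]) ^ (![0, 1, D] : Fin 3 → ℕ) l • (S l).map C).det.support.card ≤
      ((∑ l, (X : ℝ[X]) ^ (![0, 1, D] : Fin 3 → ℕ) l • (S l).map C).det.roots.toFinset.filter (fun t => 0 < t)).card + 1 := by
    omega
  have h10 : (1 : Fin (q + 2)) ≠ 0 := by simp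
  obtain ⟨P, -, hP⟩ := skewBlock_axisPair_of_sharp (![0, 1, D] : Fin 3 → ℕ) 0 S hdet hsharp 1 h10
  refine ⟨D, fun l => S l * P, ?_, ?_, fun D' => ?_⟩
  · rintro ⟨l, hl⟩ ⟨l', hl'⟩ hll'
    rw [Fin.mk_lt_mk] at hll'
    interval_cases l <;> interval_cases l' <;> first | omega | (simp <;> omega)
  · rintro ⟨l, hl⟩
    interval_cases l
    · simp
    · simp
      omega
    · simp
  · obtain ⟨η, hη, h1, h2, h3, h4, h5⟩ := hP D'
    refine ⟨η, hη, h1, h2, h3, h4, le_trans ?_ h5⟩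
    have := two_mul_choose_sub_one (q + 1)
    rw [show q + 1 + 3 = q + 4 by ring, show q + 1 + 1 = q + 2 by ring, show q + 1 + 4 = q + 5 by ring] at this
    omega

end AxisPairSharp

end Summit.ValiantsHypothesis.ValiantsHypothesis.Theorems.KPlusLogSqLaw.TowerGraft
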